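import Summits.Ventures.LatticeQCDFlow.Exactness.FlowSamplerSquareIntegrableMonotone
import Summits.Ventures.LatticeQCDFlow.Exactness.IMHStickingFloorAllLags
import Literature.Analysis.FunctionSpaces.WeakCompactnessL1Proofs
import HarnessLib

/-!
# The all-lag STICKING FLOOR on `L²(e^{−S})`: `∫ g (Kⁿ⁺¹ g) w ≥ ∫ g² w rⁿ⁺¹` for EVERY square-integrable observable of the exact flow sampler — by truncation, not by a second Smith–Tierney induction

HONEST FRAMING: exact (Metropolis-corrected) sampling algorithms for lattice gauge theory;
figures of merit are autocorrelation/cost numbers at stated couplings and volumes; no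
continuum-physics claim.  (SCALAR calibration rung S0-A: not a gauge result.)

Venture `LatticeQCDFlow` (cell pub-lqcd), topic `Exactness`; FANOUT row 2 (`s0-phi4`, FLOW arm:
independence Metropolis `K = imhOp μ w q̃`).  NEW WORK of the cell — row 2's leftover (β⁹): the
bounded-observable floor `IMHStickingFloorAllLags.autocov_ge_sticking` (Smith–Tierney kernel +
layer cake) extended to the class of measurable SQUARE-INTEGRABLE observables (the magnetisation of
lattice φ⁴ is unbounded) WITHOUT re-running the Smith–Tierney induction on `L¹`: a format-level
CONTINUITY LEMMA (every autocovariance `C_h(k) = ∫ h (Kᵏ h) w` of a reversible contraction is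
continuous along `L²(w)`-convergent sequences in the admissible class — linearity, Cauchy–Schwarz,
contraction; no spectral theorem) plus two-sided truncations `g_N = (−N) ∨ (g ∧ N) → g` in `L²(w)`
(dominated convergence; the truncation facts `max_neg_min_eq_self`, `abs_max_neg_min_le` are the
tree's, `Literature/Analysis/FunctionSpaces/WeakCompactnessL1Proofs`).  Nothing is cited as a fact
(Smith–Tierney 1996 / Wang 2020 NAMED in the bounded file).

## What is proved

Format level (namespace `RevOp`; (int), (comb), (stab), (lin), (contr)):
* **`tendsto_autocov_of_tendsto_sq`** — `g, G_N ∈ A`, `∫ (G_N − g)² w → 0` ⇒ for every `k`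
  `C_{G_N}(k) → C_g(k)`  (`|C_{G_N}(k) − C_g(k)|² ≤ 2 δ_N (3 C_g(0) + 2 δ_N)`, `δ_N = ‖G_N − g‖²`).

Truncation (`(−B) ∨ (B ∧ x)`): `sq_trunc_sub_le`, `sq_trunc_le`; for measurable square-integrable `g`:
`tendsto_sq_trunc_sub` (`∫ (g_N − g)² w → 0`).

General space (`(X, μ)` s-finite; `w, q > 0` measurable integrable, `∫ q = 1`;
`r(x) = ∫ (1 − α(x,z)) q(z)` the rejection probability; `g` measurable with `∫ g² w < ∞`):
* **`imhOp_autocov_ge_sticking_of_sq`** — for EVERY `n`: `∫ g² w r^{n+1} ≤ ∫ g (Kⁿ⁺¹ g) w`;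
* **`imhOp_autocorr_ge_sticking_of_sq`** — `ρ_g(n+1) ≥ E_{g²w}[r^{n+1}]/E[g²w]`;
* **`imhOp_tauInt_ge_stickingSum_of_sq`** — summable series ⇒ for every `N`,
  `½ + Σ_{n<N} E_{g²w}[r^{n+1}]/E[g²w] ≤ τ_int(g)` (all autocorrelations `≥ 0` on `L²(w)`).

Lattice instances (every `PolyObs` of lattice φ⁴, the magnetisation `M`) are
`Phi4FlowSquareIntegrableSticking.lean`.
Reading: by Jensen `E_{g²}[rᵏ] ≥ (E_{g²}[r])ᵏ = r̄ᵏ`, so for the magnetisation every lag obeys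
`ρ_M(k) ≥ E_{M̃²}[rᵏ]/Var M ≥ r̄_Mᵏ` — sticky configurations floor EVERY lag of `M`, not only `ρ(1)`.
NOT CLAIMED: any value of `r` for any run or trained network; anything for the HMC / local arms.
-/

namespace Summit.Ventures.LatticeQCDFlow.Exactness

open Real MeasureTheory Filter Finset Set Topology
open Summit.Ventures.LatticeQCDFlow.Scoring Literature.Analysis.FunctionSpaces

/-! ## §1 Format level: autocovariances are continuous along `L²(w)`-convergent sequences -/

namespace RevOp

variable {X : Type*} [MeasurableSpace X] {μ : Measure X} {w : X → ℝ} {A : (X → ℝ) → Prop}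
  {K : (X → ℝ) → (X → ℝ)}

/-- **CONTINUITY OF EVERY AUTOCOVARIANCE IN `L²(w)`** (`RevOp` format, no symmetry needed):
if `g ∈ A`, `G_N ∈ A` and `δ_N = ∫ (G_N − g)² w → 0`, then `C_{G_N}(k) → C_g(k)` for every lag `k`
(`C_{G_N}(k) − C_g(k) = ⟨G_N − g, Kᵏ G_N⟩ + ⟨g, Kᵏ(G_N − g)⟩`, Cauchy–Schwarz, `Kᵏ` a contraction). -/
theorem tendsto_autocov_of_tendsto_sq (hw0 : ∀ x, 0 ≤ w x)
    (hAi : ∀ ⦃f h : X → ℝ⦄, A f → A h → Integrable (fun x => f x * h x * w x) μ)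
    (hAc : ∀ ⦃f h : X → ℝ⦄ (c : ℝ), A f → A h → A (fun x => f x + c * h x))
    (hAK : ∀ ⦃f : X → ℝ⦄, A f → A (K f))
    (hlin : ∀ ⦃f h : X → ℝ⦄ (c : ℝ), A f → A h →
      ∀ x, K (fun s => f s + c * h s) x = K f x + c * K h x)
    (hcontr : ∀ ⦃f : X → ℝ⦄, A f → ∫ x, K f x ^ 2 * w x ∂μ ≤ ∫ x, f x ^ 2 * w x ∂μ)
    {g : X → ℝ} (hg : A g) {G : ℕ → X → ℝ} (hG : ∀ N, A (G N))
    (hlim : Tendsto (fun N => ∫ x, (G N x - g x) ^ 2 * w x ∂μ) atTop (𝓝 0)) (k : ℕ) :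
    Tendsto (fun N => ∫ x, G N x * (K^[k] (G N)) x * w x ∂μ) atTop
      (𝓝 (∫ x, g x * (K^[k] g) x * w x ∂μ)) := by
  set P := ∫ x, g x ^ 2 * w x ∂μ with hPdef
  set C := ∫ x, g x * (K^[k] g) x * w x ∂μ with hCdef
  have hP0 : 0 ≤ P := integral_nonneg fun x => mul_nonneg (sq_nonneg _) (hw0 x)
  set δ : ℕ → ℝ := fun N => ∫ x, (G N x - g x) ^ 2 * w x ∂μ with hδ
  have hδ0 : ∀ N, 0 ≤ δ N := fun N => integral_nonneg fun x => mul_nonneg (sq_nonneg _) (hw0 x)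
  -- the differences `d_N = G_N − g` are class members
  have hd : ∀ N, A (fun x => G N x - g x) := fun N => by
    have h := hAc (-1) (hG N) hg
    have e : (fun x => G N x + (-1) * g x) = fun x => G N x - g x := by funext x; ring
    rw [e] at h; exact h
  have hbound : ∀ N, ((∫ x, G N x * (K^[k] (G N)) x * w x ∂μ) - C) ^ 2
      ≤ 2 * δ N * (3 * P + 2 * δ N) := by
    intro N
    have hGk := iterate_mem hAK k (hG N)
    have hdk := iterate_mem hAK k (hd N)
    have hgk := iterate_mem hAK k hg
    -- linearity of `Kᵏ` on the class: `Kᵏ(G_N − g) = Kᵏ G_N − Kᵏ g`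
    have hlinK : ∀ x, (K^[k] (fun y => G N y - g y)) x = (K^[k] (G N)) x - (K^[k] g) x := by
      intro x
      have h := iterate_add_mul hAK hlin (-1) k (hG N) hg x
      have e : (fun s => G N s + (-1) * g s) = fun y => G N y - g y := by funext s; ring
      rw [e] at h
      rw [h]; ring
    -- the difference identity
    have i1 := hAi (hG N) hGk
    have i2 := hAi hg hGk
    have i3 := hAi hg hgk
    set a := ∫ x, (G N x - g x) * (K^[k] (G N)) x * w x ∂μ with ha
    set b := ∫ x, g x * (K^[k] (fun y => G N y - g y)) x * w x ∂μ with hb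
    have ha' : a = (∫ x, G N x * (K^[k] (G N)) x * w x ∂μ) - ∫ x, g x * (K^[k] (G N)) x * w x ∂μ := by
      rw [ha, ← integral_sub i1 i2]
      exact integral_congr_ae (Eventually.of_forall fun x => by ring)
    have hb' : b = (∫ x, g x * (K^[k] (G N)) x * w x ∂μ) - C := by
      rw [hb, hCdef, ← integral_sub i2 i3]
      refine integral_congr_ae (Eventually.of_forall fun x => ?_)
      show g x * (K^[k] (fun y => G N y - g y)) x * w x
        = g x * (K^[k] (G N)) x * w x - g x * (K^[k] g) x * w x
      rw [hlinK x]; ring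
    have hdiff : (∫ x, G N x * (K^[k] (G N)) x * w x ∂μ) - C = a + b := by rw [ha', hb']; ring
    -- Cauchy–Schwarz and contraction
    have hCSa : a ^ 2 ≤ δ N * ∫ x, (K^[k] (G N)) x ^ 2 * w x ∂μ := sq_integral_mul_le hw0 hAi (hd N) hGk
    have hCSb : b ^ 2 ≤ P * ∫ x, (K^[k] (fun y => G N y - g y)) x ^ 2 * w x ∂μ :=
      sq_integral_mul_le hw0 hAi hg hdk
    have hcG : ∫ x, (K^[k] (G N)) x ^ 2 * w x ∂μ ≤ ∫ x, G N x ^ 2 * w x ∂μ :=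
      iterate_contr hAK hcontr k (hG N)
    have hcd : ∫ x, (K^[k] (fun y => G N y - g y)) x ^ 2 * w x ∂μ ≤ δ N :=
      iterate_contr hAK hcontr k (hd N)
    -- `∫ G_N² w ≤ 2P + 2δ_N`
    have hQ : ∫ x, G N x ^ 2 * w x ∂μ ≤ 2 * P + 2 * δ N := by
      have iG2 := integrable_sq_mul hAi (hG N)
      have ig2 := integrable_sq_mul hAi hg
      have id2 := integrable_sq_mul hAi (hd N)
      calc ∫ x, G N x ^ 2 * w x ∂μ ≤ ∫ x, (2 * (g x ^ 2 * w x) + 2 * ((G N x - g x) ^ 2 * w x)) ∂μ := by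
            refine integral_mono iG2 ((ig2.const_mul 2).add (id2.const_mul 2)) fun x => ?_
            have h : G N x ^ 2 ≤ 2 * g x ^ 2 + 2 * (G N x - g x) ^ 2 := by
              nlinarith [sq_nonneg (G N x - 2 * g x)]
            calc G N x ^ 2 * w x ≤ (2 * g x ^ 2 + 2 * (G N x - g x) ^ 2) * w x :=
                  mul_le_mul_of_nonneg_right h (hw0 x)
              _ = 2 * (g x ^ 2 * w x) + 2 * ((G N x - g x) ^ 2 * w x) := by ring
        _ = 2 * P + 2 * δ N := by
            rw [integral_add (ig2.const_mul 2) (id2.const_mul 2), integral_const_mul, integral_const_mul]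
    have hK0 : 0 ≤ ∫ x, (K^[k] (G N)) x ^ 2 * w x ∂μ :=
      integral_nonneg fun x => mul_nonneg (sq_nonneg _) (hw0 x)
    have ha2 : a ^ 2 ≤ δ N * (2 * P + 2 * δ N) :=
      hCSa.trans (mul_le_mul_of_nonneg_left (hcG.trans hQ) (hδ0 N))
    have hb2 : b ^ 2 ≤ P * δ N := hCSb.trans (mul_le_mul_of_nonneg_left hcd hP0)
    rw [hdiff]
    nlinarith [sq_nonneg (a - b)]
  have he : Tendsto (fun N => 2 * δ N * (3 * P + 2 * δ N)) atTop (𝓝 0) := by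
    have h := (hlim.const_mul 2).mul ((hlim.const_mul 2).const_add (3 * P))
    simpa using h
  have hsq : Tendsto (fun N => ((∫ x, G N x * (K^[k] (G N)) x * w x ∂μ) - C) ^ 2) atTop (𝓝 0) :=
    squeeze_zero (fun N => sq_nonneg _) hbound he
  have habs : Tendsto (fun N => |(∫ x, G N x * (K^[k] (G N)) x * w x ∂μ) - C|) atTop (𝓝 0) := by
    have h := (Real.continuous_sqrt.tendsto 0).comp hsq
    rw [Real.sqrt_zero] at h
    exact h.congr fun N => Real.sqrt_sq_eq_abs _
  rw [tendsto_iff_dist_tendsto_zero]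
  exact habs.congr fun N => (Real.dist_eq _ _).symm

end RevOp

/-! ## §2 Two-sided truncations of a square-integrable observable -/

/-- The truncation error is dominated by the observable: `((−B) ∨ (B ∧ x) − x)² ≤ x²` (`B ≥ 0`). -/
theorem sq_trunc_sub_le {B : ℝ} (hB : 0 ≤ B) (x : ℝ) : (max (-B) (min B x) - x) ^ 2 ≤ x ^ 2 := by
  rcases le_total x B with h1 | h1
  · rw [min_eq_right h1]
    rcases le_total (-B) x with h2 | h2
    · rw [max_eq_right h2, sub_self, zero_pow two_ne_zero]; positivity
    · rw [max_eq_left h2]; nlinarith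
  · rw [min_eq_left h1, max_eq_right (by linarith : -B ≤ B)]; nlinarith

/-- The truncation is dominated by the observable: `((−B) ∨ (B ∧ x))² ≤ x²` (`B ≥ 0`). -/
theorem sq_trunc_le {B : ℝ} (hB : 0 ≤ B) (x : ℝ) : (max (-B) (min B x)) ^ 2 ≤ x ^ 2 := by
  rcases le_total x B with h1 | h1
  · rw [min_eq_right h1]
    rcases le_total (-B) x with h2 | h2
    · rw [max_eq_right h2]
    · rw [max_eq_left h2]; nlinarith
  · rw [min_eq_left h1, max_eq_right (by linarith : -B ≤ B)]; nlinarith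

section General

variable {X : Type*} [MeasurableSpace X] {μ : Measure X} {w q : X → ℝ}

/-- The truncations `g_N = (−N) ∨ (N ∧ g)` of a measurable `g` are measurable and bounded by `N`. -/
theorem trunc_measurable_bdd {g : X → ℝ} (hgm : Measurable g) (N : ℕ) :
    Measurable (fun t => max (-(N : ℝ)) (min (N : ℝ) (g t))) ∧
    ∀ t, |max (-(N : ℝ)) (min (N : ℝ) (g t))| ≤ N :=
  ⟨measurable_const.max (measurable_const.min hgm), fun t => abs_max_neg_min_le (Nat.cast_nonneg N) (g t)⟩

/-- **Truncations converge in `L²(w)`**: for measurable `g` with `∫ g² w < ∞` (`w ≥ 0`),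
`∫ (g_N − g)² w → 0` (dominated convergence: `(g_N − g)² ≤ g²`, and `g_N(t) = g(t)` once `N ≥ |g(t)|`). -/
theorem tendsto_sq_trunc_sub (hw0 : ∀ t, 0 ≤ w t) (hwm : Measurable w) {g : X → ℝ}
    (hgm : Measurable g) (hg2 : Integrable (fun t => g t ^ 2 * w t) μ) :
    Tendsto (fun N : ℕ => ∫ t, (max (-(N : ℝ)) (min (N : ℝ) (g t)) - g t) ^ 2 * w t ∂μ) atTop (𝓝 0) := by
  have h := tendsto_integral_of_dominated_convergence (μ := μ)
    (F := fun (N : ℕ) t => (max (-(N : ℝ)) (min (N : ℝ) (g t)) - g t) ^ 2 * w t)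
    (f := fun _ => (0 : ℝ)) (fun t => g t ^ 2 * w t)
    (fun N => ((((trunc_measurable_bdd hgm N).1.sub hgm).pow_const 2).mul hwm).aestronglyMeasurable)
    hg2 (fun N => Eventually.of_forall fun t => by
      rw [Real.norm_eq_abs, abs_of_nonneg (mul_nonneg (sq_nonneg _) (hw0 t))]
      exact mul_le_mul_of_nonneg_right (sq_trunc_sub_le (Nat.cast_nonneg N) _) (hw0 t))
    (Eventually.of_forall fun t => by
      obtain ⟨N₀, hN₀⟩ := exists_nat_ge |g t|
      refine tendsto_const_nhds.congr' ?_
      filter_upwards [eventually_ge_atTop N₀] with N hN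
      have hle : |g t| ≤ (N : ℝ) := hN₀.trans (Nat.cast_le.2 hN)
      rw [max_neg_min_eq_self hle]
      ring)
  simpa using h

variable [SFinite μ]

/-! ## §3 The all-lag sticking floor on `L²(w)` -/

/-- **THE ALL-LAG STICKING FLOOR FOR EVERY SQUARE-INTEGRABLE OBSERVABLE.**  `w, q > 0` measurable
integrable with `∫ q = 1`, `K = imhOp μ w q`, `r(x) = ∫ (1 − α(x,z)) q(z) dμ(z)` the rejection
probability; `g` measurable with `∫ g² w < ∞`.  For every `n`:
`∫ g² w r^{n+1} dμ ≤ ∫ g (Kⁿ⁺¹ g) w dμ` — the bounded floor passed to the limit along truncations. -/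
theorem imhOp_autocov_ge_sticking_of_sq (hw0 : ∀ t, 0 < w t) (hwm : Measurable w)
    (hwi : Integrable w μ) (hq0 : ∀ t, 0 < q t) (hqm : Measurable q) (hqi : Integrable q μ)
    (hq1 : ∫ z, q z ∂μ = 1) (n : ℕ) {g : X → ℝ} (hgm : Measurable g)
    (hg2 : Integrable (fun t => g t ^ 2 * w t) μ) :
    ∫ x, g x ^ 2 * w x * (∫ z, (1 - imhAcceptQ w q x z) * q z ∂μ) ^ (n + 1) ∂μ
      ≤ ∫ x, g x * ((imhOp μ w q)^[n + 1] g) x * w x ∂μ := by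
  have hw0' : ∀ t, 0 ≤ w t := fun t => (hw0 t).le
  obtain ⟨hr0, hr1, hrm⟩ := rejection_bounds (μ := μ) hw0 hwm hq0 hqm hqi hq1
  set G : ℕ → X → ℝ := fun N t => max (-(N : ℝ)) (min (N : ℝ) (g t)) with hGdef
  have hGm : ∀ N, Measurable (G N) := fun N => (trunc_measurable_bdd hgm N).1
  have hGb : ∀ N t, |G N t| ≤ N := fun N => (trunc_measurable_bdd hgm N).2
  have hG2 : ∀ N, Integrable (fun t => G N t ^ 2 * w t) μ :=
    fun N => sq_integrable_of_bdd hw0' hwm hwi (hGm N) (hGb N)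
  -- the bounded floor for each truncation
  have hstep : ∀ N, ∫ x, G N x ^ 2 * w x * (∫ z, (1 - imhAcceptQ w q x z) * q z ∂μ) ^ (n + 1) ∂μ
      ≤ ∫ x, G N x * ((imhOp μ w q)^[n + 1] (G N)) x * w x ∂μ :=
    fun N => autocov_ge_sticking hw0 hwm hwi hq0 hqm hqi hq1 n (hGm N) (hGb N)
  -- left side: dominated convergence (`G_N² w r^{n+1} ≤ g² w`)
  have hL : Tendsto (fun N => ∫ x, G N x ^ 2 * w x
      * (∫ z, (1 - imhAcceptQ w q x z) * q z ∂μ) ^ (n + 1) ∂μ) atTop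
      (𝓝 (∫ x, g x ^ 2 * w x * (∫ z, (1 - imhAcceptQ w q x z) * q z ∂μ) ^ (n + 1) ∂μ)) := by
    refine tendsto_integral_of_dominated_convergence (fun t => g t ^ 2 * w t)
      (fun N => ((((hGm N).pow_const 2).mul hwm).mul (hrm.pow_const _)).aestronglyMeasurable) hg2
      (fun N => Eventually.of_forall fun t => ?_) (Eventually.of_forall fun t => ?_)
    · have hrp : 0 ≤ (∫ z, (1 - imhAcceptQ w q t z) * q z ∂μ) ^ (n + 1)
          ∧ (∫ z, (1 - imhAcceptQ w q t z) * q z ∂μ) ^ (n + 1) ≤ 1 :=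
        ⟨pow_nonneg (hr0 t) _, pow_le_one₀ (hr0 t) (hr1 t)⟩
      rw [Real.norm_eq_abs, abs_of_nonneg (mul_nonneg (mul_nonneg (sq_nonneg _) (hw0' t)) hrp.1)]
      calc G N t ^ 2 * w t * (∫ z, (1 - imhAcceptQ w q t z) * q z ∂μ) ^ (n + 1)
          ≤ g t ^ 2 * w t * 1 :=
            mul_le_mul (mul_le_mul_of_nonneg_right (sq_trunc_le (Nat.cast_nonneg N) _) (hw0' t))
              hrp.2 hrp.1 (mul_nonneg (sq_nonneg _) (hw0' t))
        _ = g t ^ 2 * w t := mul_one _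
    · obtain ⟨N₀, hN₀⟩ := exists_nat_ge |g t|
      refine tendsto_const_nhds.congr' ?_
      filter_upwards [eventually_ge_atTop N₀] with N hN
      have hle : |g t| ≤ (N : ℝ) := hN₀.trans (Nat.cast_le.2 hN)
      show g t ^ 2 * w t * (∫ z, (1 - imhAcceptQ w q t z) * q z ∂μ) ^ (n + 1)
        = G N t ^ 2 * w t * (∫ z, (1 - imhAcceptQ w q t z) * q z ∂μ) ^ (n + 1)
      simp only [hGdef]
      rw [max_neg_min_eq_self hle]
  -- right side: continuity of the autocovariance along `G_N → g` in `L²(w)`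
  have hR : Tendsto (fun N => ∫ x, G N x * ((imhOp μ w q)^[n + 1] (G N)) x * w x ∂μ) atTop
      (𝓝 (∫ x, g x * ((imhOp μ w q)^[n + 1] g) x * w x ∂μ)) :=
    RevOp.tendsto_autocov_of_tendsto_sq (A := fun f : X → ℝ => Measurable f ∧
        Integrable (fun t => f t ^ 2 * w t) μ) (K := imhOp μ w q) hw0' (sqClass_int hw0 hwm)
      (sqClass_comb hw0 hwm) (sqClass_stab hw0 hwm hwi hq0 hqm hqi hq1)
      (sqClass_lin hw0 hwm hwi hq0 hqm hqi) (sqClass_contr hw0 hwm hwi hq0 hqm hqi hq1) ⟨hgm, hg2⟩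
      (fun N => ⟨hGm N, hG2 N⟩) (tendsto_sq_trunc_sub hw0' hwm hgm hg2) (n + 1)
  exact le_of_tendsto_of_tendsto' hL hR hstep

/-- **`ρ(n+1) ≥ E_{g²w}[r^{n+1}]/E[g²w]` on `L²(w)`** (normalised form). -/
theorem imhOp_autocorr_ge_sticking_of_sq (hw0 : ∀ t, 0 < w t) (hwm : Measurable w)
    (hwi : Integrable w μ) (hq0 : ∀ t, 0 < q t) (hqm : Measurable q) (hqi : Integrable q μ)
    (hq1 : ∫ z, q z ∂μ = 1) (n : ℕ) {g : X → ℝ} (hgm : Measurable g)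
    (hg2 : Integrable (fun t => g t ^ 2 * w t) μ) :
    (∫ x, g x ^ 2 * w x * (∫ z, (1 - imhAcceptQ w q x z) * q z ∂μ) ^ (n + 1) ∂μ)
        / ∫ x, g x ^ 2 * w x ∂μ
      ≤ (∫ x, g x * ((imhOp μ w q)^[n + 1] g) x * w x ∂μ) / ∫ x, g x ^ 2 * w x ∂μ :=
  div_le_div_of_nonneg_right (imhOp_autocov_ge_sticking_of_sq hw0 hwm hwi hq0 hqm hqi hq1 n hgm hg2)
    (integral_nonneg fun x => mul_nonneg (sq_nonneg _) (hw0 x).le)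

/-- **Partial-sum sticking floor on `τ_int`, on `L²(w)`.**  If the autocorrelation series of the
square-integrable `g` is summable, then for every `N`:
`½ + Σ_{n<N} E_{g²w}[r^{n+1}]/E[g²w] ≤ τ_int(g)` (every autocorrelation is `≥ 0` on `L²(w)` and at
least its sticking moment). -/
theorem imhOp_tauInt_ge_stickingSum_of_sq (hw0 : ∀ t, 0 < w t) (hwm : Measurable w)
    (hwi : Integrable w μ) (hq0 : ∀ t, 0 < q t) (hqm : Measurable q) (hqi : Integrable q μ)
    (hq1 : ∫ z, q z ∂μ = 1) {g : X → ℝ} (hgm : Measurable g)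
    (hg2 : Integrable (fun t => g t ^ 2 * w t) μ)
    (hs : Summable fun n => (∫ x, g x * ((imhOp μ w q)^[n + 1] g) x * w x ∂μ)
      / ∫ x, g x ^ 2 * w x ∂μ) (N : ℕ) :
    1 / 2 + ∑ n ∈ Finset.range N,
        (∫ x, g x ^ 2 * w x * (∫ z, (1 - imhAcceptQ w q x z) * q z ∂μ) ^ (n + 1) ∂μ)
          / ∫ x, g x ^ 2 * w x ∂μ
      ≤ tauInt (fun n => (∫ x, g x * ((imhOp μ w q)^[n] g) x * w x ∂μ) / ∫ x, g x ^ 2 * w x ∂μ) := by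
  have hA0 : 0 ≤ ∫ x, g x ^ 2 * w x ∂μ := integral_nonneg fun x => mul_nonneg (sq_nonneg _) (hw0 x).le
  have hnn : ∀ n, 0 ≤ (∫ x, g x * ((imhOp μ w q)^[n + 1] g) x * w x ∂μ) / ∫ x, g x ^ 2 * w x ∂μ :=
    fun n => div_nonneg (imhOp_autocov_shape_of_sq hw0 hwm hwi hq0 hqm hqi hq1 hgm hg2 n).1 hA0
  have h1 : ∑ n ∈ Finset.range N,
      (∫ x, g x ^ 2 * w x * (∫ z, (1 - imhAcceptQ w q x z) * q z ∂μ) ^ (n + 1) ∂μ)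
        / ∫ x, g x ^ 2 * w x ∂μ
      ≤ ∑ n ∈ Finset.range N,
        (∫ x, g x * ((imhOp μ w q)^[n + 1] g) x * w x ∂μ) / ∫ x, g x ^ 2 * w x ∂μ :=
    Finset.sum_le_sum fun n _ => imhOp_autocorr_ge_sticking_of_sq hw0 hwm hwi hq0 hqm hqi hq1 n hgm hg2
  have h2 := hs.sum_le_tsum (Finset.range N) fun n _ => hnn n
  unfold tauInt
  linarith

end General

end Summit.Ventures.LatticeQCDFlow.Exactness
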